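import Summits.NavierStokesRegularity.NavierStokesRegularity.Theorems.SqueezeCycleRecurrentLiouvilleClassLimit
import Summits.NavierStokesRegularity.NavierStokesRegularity.Theorems.SqueezeCycleRecurrentLiouvilleAxisymRegular
import Summits.NavierStokesRegularity.NavierStokesRegularity.Theorems.SqueezeCycleRecurrentLiouvilleAxisymOfLimit
import HarnessLib

/-!
# Crux `RecurrentLiouville` (stmt-NavierStokesRegularity-1589), line `Sketch` — Branch C:
  near-axisymmetric Type-I profiles of the Albritton–Barker class are regular

`nearAxisymmetricRemoval` (registered alias `stub_rlNearAxisymmetricRemoval`): for every rate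
constant `C` and bound `M < ⊤` there is `δ = δ(C, M) > 0` such that a suitable weak solution of
Navier–Stokes (`ν = 1`, `f = 0`) on `ℝ³ × ℝ₋` with a weak gradient, `𝐈(ℝ³ × ℝ₋) ≤ M` and the Type-I
rate `‖u‖ ≤ C/√(−t)`, which is `δ`-close in `L³(Q(0,2))` to some field with axisymmetric slices, is
regular at the space–time origin: the OPENNESS of the Seregin–Šverák axisymmetric rung (an
axisymmetric singularity cannot be of Type I; `Literature.Barriers.NavierStokesRegularity.
AxisymmetricTypeIExclusion`, proved in tree as `axisymmetricTypeIExclusion_of_tree`) inside the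
crux's compact class, with "distance to axisymmetry" measured in `L³` on one ball.  First lemma
(ii) of the card `rung-neighbourhoods`; with `δ = 0` it is the axisymmetric sub-case of the crux.

Proof: contradiction + compactness, composing `stub_rlClassLimit` (A–B Lemma 2.2 + Prop. 2.3 +
pointwise-rate representative), `stub_rlAxisymOfLimit` (L³-limits of near-axisymmetric fields are
a.e. axisymmetric) and `stub_rlAxisymRegular` (an a.e.-axisymmetric class profile is regular).

## References

* G. Seregin, V. Šverák, Comm. PDE 34 (2009) = arXiv:0804.1803, Thm. 3.1 (= Thm. 1.1). [SereginSverak2009]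
* D. Albritton, T. Barker, J. Math. Fluid Mech. 21 (2019) = arXiv:1811.00502, Lemma 2.2, Prop. 2.3.
  [AlbrittonBarker2019]
-/

noncomputable section

-- the sub-problem namespace repeats the summit name (D-0017 layout `Summit.<S>.<P>.Theorems`)
set_option linter.dupNamespace false

namespace Summit.NavierStokesRegularity.NavierStokesRegularity.Theorems

open MeasureTheory Set Function Filter Topology TopologicalSpace Metric
open Literature.Analysis.FluidPDE
open scoped NNReal ENNReal

/-- **Branch C — near-axisymmetric removal (openness of the Seregin–Šverák axisymmetric rung in the
Albritton–Barker class).**  For every rate constant `C` and bound `M < ⊤` there is `δ = δ(C, M) > 0`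
such that a suitable weak solution `(u, p)` of Navier–Stokes (`ν = 1`, `f = 0`) on `ℝ³ × ℝ₋` with
weak gradient `G`, `𝐈(ℝ³ × ℝ₋) ≤ M` and the Type-I rate `‖u(t,x)‖ ≤ C/√(−t)`, which is `δ`-close in
`L³(Q(0,2))` to SOME field all of whose slices are axisymmetric about the `x₃`-axis, is regular at
the space–time origin.  (With `δ = 0`: axisymmetric class profiles are regular — the axisymmetric
sub-case of the crux `RecurrentLiouville`.)  Proof: otherwise pick, for `δ_k = 1/(k+1)`,
origin-singular class profiles `u_k` with axisymmetric `a_k`, `‖u_k − a_k‖_{L³(Q(0,2))} ≤ δ_k`; a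
subsequence converges in every `L³(Q(0,R))` to an origin-singular class profile `w` with the rate
(`stub_rlClassLimit`, A–B Lemma 2.2 + Prop. 2.3); `w` is a.e. axisymmetric on `Q(0,2)`
(`stub_rlAxisymOfLimit`); and an a.e.-axisymmetric class profile is regular at the origin
(`stub_rlAxisymRegular`: continuous Oseen-mild representative + the local Seregin–Šverák theorem
`AxisymmetricTypeIExclusion`, proved in tree) — contradiction.
[cite: SereginSverak2009, Thm. 3.1 (= Thm. 1.1); AlbrittonBarker2019, Lemma 2.2, Prop. 2.3] -/
theorem nearAxisymmetricRemoval :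
    ∀ (C : ℝ) (M : ℝ≥0∞), M < ⊤ → ∃ δ : ℝ, 0 < δ ∧
      ∀ (u : ℝ → EuclideanSpace ℝ (Fin 3) → EuclideanSpace ℝ (Fin 3))
        (p : ℝ → EuclideanSpace ℝ (Fin 3) → ℝ)
        (G : ℝ → EuclideanSpace ℝ (Fin 3) → EuclideanSpace ℝ (Fin 3) →L[ℝ] EuclideanSpace ℝ (Fin 3)),
        IsSuitableWeakSolutionOn (slab (EuclideanSpace ℝ (Fin 3)) (Iio 0) isOpen_Iio) 1 0 u p →
        HasWeakSpatialGradientOn (slab (EuclideanSpace ℝ (Fin 3)) (Iio 0) isOpen_Iio) u G →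
        typeIBound (Iio (0 : ℝ) ×ˢ univ) u p G ≤ M →
        HasTypeITimeDecay C u →
        (∃ a : ℝ → EuclideanSpace ℝ (Fin 3) → EuclideanSpace ℝ (Fin 3),
          (∀ t : ℝ, IsAxisymmetric (a t)) ∧
          AEStronglyMeasurable (uncurry a)
            (volume.restrict (parabolicCylinder 2 (0 : ℝ × EuclideanSpace ℝ (Fin 3)))) ∧
          eLpNorm (uncurry u - uncurry a) 3
            (volume.restrict (parabolicCylinder 2 (0 : ℝ × EuclideanSpace ℝ (Fin 3)))) ≤ ENNReal.ofReal δ) →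
        ¬ IsBackwardSingularPoint u 0 := by
  intro C M hM
  by_contra hcon
  push Not at hcon
  have hδk : ∀ k : ℕ, (0 : ℝ) < 1 / ((k : ℝ) + 1) := fun k => by positivity
  choose u p G hsw hwg hI hdec hax hsing using fun k : ℕ => hcon _ (hδk k)
  choose a hax haxm haxd using hax
  -- S1: a singular class limit with the rate
  obtain ⟨w, q, H, ψ, hψ, hsw', hwg', hI', hdec', hsing', hconv⟩ :=
    stub_rlClassLimit C M hM u p G hsw hwg hI hdec hsing
  -- measurability on `Q(0,2)`
  have hmeas : ∀ k, AEStronglyMeasurable (uncurry (u k))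
      (volume.restrict (parabolicCylinder 2 (0 : ℝ × EuclideanSpace ℝ (Fin 3)))) := fun k =>
    (hwg k).locallyIntegrableOn.aestronglyMeasurable.mono_measure
      (Measure.restrict_mono (parabolicCylinder_origin_subset_slab _) le_rfl)
  have hmeasw : AEStronglyMeasurable (uncurry w)
      (volume.restrict (parabolicCylinder 2 (0 : ℝ × EuclideanSpace ℝ (Fin 3)))) :=
    hwg'.locallyIntegrableOn.aestronglyMeasurable.mono_measure
      (Measure.restrict_mono (parabolicCylinder_origin_subset_slab _) le_rfl)
  -- C2: the limit is a.e. axisymmetric on `Q(0,2)`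
  have hδψ : Tendsto (fun j : ℕ => 1 / (((ψ j : ℕ) : ℝ) + 1)) atTop (𝓝 0) :=
    (tendsto_one_div_add_atTop_nhds_zero_nat (𝕜 := ℝ)).comp hψ.tendsto_atTop
  have haxw := stub_rlAxisymOfLimit (fun j => u (ψ j)) (fun j => a (ψ j)) w
    (fun j => 1 / (((ψ j : ℕ) : ℝ) + 1)) hδψ (fun j t => hax (ψ j) t) (fun j => hmeas (ψ j))
    (fun j => haxm (ψ j)) hmeasw (hconv 2 two_pos) (fun j => haxd (ψ j))
  -- C1: an a.e.-axisymmetric class profile is regular — contradiction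
  exact stub_rlAxisymRegular C w q H hsw' hwg' hI' hdec' haxw hsing'

/-- **Registered alias** (stub `stub_rlNearAxisymmetricRemoval` of crux stmt-NavierStokesRegularity-1589,
line Sketch): near-axisymmetric class profiles are regular, verbatim `nearAxisymmetricRemoval`.
[cite: SereginSverak2009, Thm. 3.1 (= Thm. 1.1)] -/
theorem stub_rlNearAxisymmetricRemoval :
    ∀ (C : ℝ) (M : ℝ≥0∞), M < ⊤ → ∃ δ : ℝ, 0 < δ ∧
      ∀ (u : ℝ → EuclideanSpace ℝ (Fin 3) → EuclideanSpace ℝ (Fin 3))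
        (p : ℝ → EuclideanSpace ℝ (Fin 3) → ℝ)
        (G : ℝ → EuclideanSpace ℝ (Fin 3) → EuclideanSpace ℝ (Fin 3) →L[ℝ] EuclideanSpace ℝ (Fin 3)),
        IsSuitableWeakSolutionOn (slab (EuclideanSpace ℝ (Fin 3)) (Iio 0) isOpen_Iio) 1 0 u p →
        HasWeakSpatialGradientOn (slab (EuclideanSpace ℝ (Fin 3)) (Iio 0) isOpen_Iio) u G →
        typeIBound (Iio (0 : ℝ) ×ˢ univ) u p G ≤ M →
        HasTypeITimeDecay C u →
        (∃ a : ℝ → EuclideanSpace ℝ (Fin 3) → EuclideanSpace ℝ (Fin 3),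
          (∀ t : ℝ, IsAxisymmetric (a t)) ∧
          AEStronglyMeasurable (uncurry a)
            (volume.restrict (parabolicCylinder 2 (0 : ℝ × EuclideanSpace ℝ (Fin 3)))) ∧
          eLpNorm (uncurry u - uncurry a) 3
            (volume.restrict (parabolicCylinder 2 (0 : ℝ × EuclideanSpace ℝ (Fin 3)))) ≤ ENNReal.ofReal δ) →
        ¬ IsBackwardSingularPoint u 0 :=
  fun C M hM => nearAxisymmetricRemoval C M hM

end Summit.NavierStokesRegularity.NavierStokesRegularity.Theorems

end
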